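import Literature.Analysis.FluidPDE.OnsagerBDSVCorrectorCurl
import Literature.Analysis.FluidPDE.OnsagerBDSVEnergyCrossTerm
import Literature.Analysis.FluidPDE.OnsagerBDSVTransportEstimates
import Literature.Analysis.FluidPDE.OnsagerBDSVStressParams
import HarnessLib

/-!
# The BDSV energy estimate: discharge of the corrector term (G₂)

Buckmaster–De Lellis–Székelyhidi–Vicol (BDSV), *Onsager's conjecture for admissible weak
solutions*, CPAM 72 (2019) = arXiv:1701.08678, proof of Prop. 6.2, second estimate: "Using
[(5.29): `‖w_o‖₀ ≤ (M/4)δ_{q+1}^{1/2}`] and [(5.30): `‖w_c‖₀ ≲ δ_{q+1}^{1/2} ℓ⁻¹ λ_{q+1}⁻¹`] yields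
`|∫_{T³} 2w_o·w_c + |w_c|² dx| ≲ δ_{q+1} ℓ⁻¹ λ_{q+1}⁻¹`". This file PROVES the named fact
`BDSV.energy_correctorTerm` (`OnsagerBDSVEnergy.lean`): `BDSV.energy_correctorTerm_holds`,
unconditionally (the sibling `OnsagerBDSVEnergyCorrector.lean` reduces G₂ to the named fact
`BDSV.correctorPartBound` of Cor. 5.8, whose `C¹` half is not needed here and is not used).

The two sup bounds are proved here in crude form (constants depending on `c₀`, the cut-off
constant `C_η(0,1)`, the input constant `C_in` and sup bounds of the Mikado potential `V` and its
first derivative on the Mikado ball; the geometric constant `M` of Def. 5.6 is not needed for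
Prop. 6.2), from the curl computation of `OnsagerBDSVCorrectorCurl.lean`: at a point `x = proj y`
with active cut-off `ηᵢ` (at most one, §5.2 (ii)),
* `n w_{o,i}(x) = curl[fast partᵢ(y)]`, `‖fast partᵢ‖ ≤ 4n ‖T‖ C_V ρ_{q,i}^{1/2}` — so
  `‖w_o‖₀ ≤ 4‖curl‖‖T‖C_V (δ_{q+1}/c₀)^{1/2}` (Lemma 5.4: `ρ_q ≤ δ_{q+1}`, `∑∫η² ≥ c₀`);
* `n w_c(x) = curl[slow partᵢ(y)]`, `‖slow partᵢ‖ ≤ ‖T‖C_V(2‖DR̃‖ + ‖D²Φᵢ‖ + 2‖Dηᵢ‖) ρ^{1/2}` with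
  `‖D²Φᵢ‖ ≤ ℓ⁻¹` (App. B (B.5) via `BDSV.norm_gradField_two_le` and (2.19)|_{N=1}),
  `‖DR̃_{q,i}‖ ≤ 9‖T‖ℓ⁻¹` ((5.32)–(5.33) via `BDSV.norm_iteratedFDeriv_stressCL_le` and
  (2.20)|_{N=1}), `‖Dηᵢ‖ ≤ C_η(0,1)` (Lemma 5.3) — so
  `‖w_c‖₀ ≤ 2π‖curl‖‖T‖C_V(18‖T‖ + 1 + 2C_η⁺)(δ_{q+1}/c₀)^{1/2} ℓ⁻¹ λ_{q+1}⁻¹` (`n⁻¹ = 2π/λ_{q+1}`);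
and then `|∫ 2w_o·w_c + |w_c|²| = |∫⟪2w_o + w_c, w_c⟫| ≤ (2‖w_o‖₀ + ‖w_c‖₀)‖w_c‖₀ ≲ δ_{q+1}ℓ⁻¹λ_{q+1}⁻¹`
by (6.6) = arXiv (6.4) `ℓλ_{q+1} ≥ 1`. The thresholds: `α < βb(b-1)` and `α < (b-1)(1-β)/2`;
`N̄ = 1`; `a` beyond the thresholds of `4δ_{q+2} ≤ δ_{q+1}λ_q^{-α}`, of the deformation bound
`exp(4C_inℓ^{2α}) - 1 ≤ 1/300` (Lemma 5.4 (5.14)), of the stress bound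
`800(1 + ‖ofCols‖)C_in(λ_qℓ)^α ≤ 1` (Lemma 5.4: `R̃_{q,i}` in the Mikado ball) and of `ℓλ_{q+1} ≥ 1`.

## References

* T. Buckmaster, C. De Lellis, L. Székelyhidi Jr., V. Vicol, *Onsager's conjecture for admissible
  weak solutions*, Comm. Pure Appl. Math. 72 (2019) 229–274 = arXiv:1701.08678: proof of
  Prop. 6.2 (second estimate); Cor. 5.8 (5.29)–(5.30); Prop. 5.7 (5.32)–(5.33); Lemma 5.4;
  §5.3 (5.27)–(5.28); §6.1.1 (6.6); App. B (B.4)–(B.5).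
-/

open MeasureTheory Set
open scoped NNReal ENNReal ContDiff InnerProductSpace Matrix Matrix.Norms.Elementwise

noncomputable section

namespace Literature.Analysis.FluidPDE

namespace BDSV

open FunctionSpaces FunctionSpaces.Torus

/-- The flat three-torus `T³ = (ℝ/ℤ)³`, local notation. -/
local notation "𝕋³" => UnitAddTorus (Fin 3)

/-- Euclidean `ℝ³`, local notation. -/
local notation "ℝ³" => EuclideanSpace ℝ (Fin 3)

/-- Real `3 × 3` matrices, local notation. -/
local notation "𝕄" => Matrix (Fin 3) (Fin 3) ℝ

/-- Continuous linear endomorphisms of `ℝ³`, local notation. -/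
local notation "𝕃" => (EuclideanSpace ℝ (Fin 3) →L[ℝ] EuclideanSpace ℝ (Fin 3))

/-! ## Bridges and parameter thresholds -/

section Bridge

variable {F : Type*} [NormedAddCommGroup F] [NormedSpace ℝ F]

/-- A bound `‖g‖_{C^{k,r}} ≤ B` (`B ≥ 0`) bounds the derivatives of the periodic lift:
`‖Dʲ(lift g)(y)‖ ≤ B` for `j ≤ k` (a local variant of the lemma of the same content in
`OnsagerBDSVGluingProofs.lean`, whose import closure is not wanted here). [folklore] -/
private theorem norm_iteratedFDeriv_lift_le_of_holder_le {g : 𝕋³ → F} {k j : ℕ} (hj : j ≤ k)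
    {r : ℝ≥0} {B : ℝ} (hB : 0 ≤ B) (h : Torus.eContDiffHolderNorm k r g ≤ ENNReal.ofReal B)
    (y : ℝ³) : ‖iteratedFDeriv ℝ j (lift g) y‖ ≤ B := by
  have h1 : ‖iteratedFDeriv ℝ j (lift g) y‖ₑ ≤ ENNReal.ofReal B := by
    refine le_trans ((enorm_le_eSupNorm _ y).trans ?_) h
    unfold Torus.eContDiffHolderNorm FunctionSpaces.eContDiffHolderNorm
    refine le_add_right ?_
    exact Finset.single_le_sum (f := fun j => eSupNorm (iteratedFDeriv ℝ j (lift g)))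
      (fun _ _ => zero_le) (Finset.mem_range.2 (Nat.lt_succ_of_le hj))
  rwa [← ofReal_norm, ENNReal.ofReal_le_ofReal_iff hB] at h1

/-- **Deformation threshold**: for `0 ≤ C`, `0 < α`, `0 ≤ β`, `1 ≤ b` and `a` large,
`exp(4Cℓ_q^{2α}) - 1 ≤ 1/300` for all `q` (`ℓ^{2α} → 0`; `eˣ - 1 ≤ 2x` for `0 ≤ x ≤ 1`).
[cite: BuckmasterEtAl2018, Lemma 5.4 (5.14)] -/
theorem exists_threshold_deformation {β b α : ℝ} (hβ : 0 ≤ β) (hb : 1 ≤ b) (hα : 0 < α) {C : ℝ}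
    (hC : 0 ≤ C) :
    ∃ a₀ : ℝ, 1 < a₀ ∧ ∀ a : ℝ, a₀ ≤ a → ∀ q : ℕ,
      Real.exp (4 * (C * mollScale β α a b q ^ (2 * α))) - 1 ≤ 1 / 300 := by
  obtain ⟨a₀, ha₀, h⟩ := exists_threshold_mollScale_rpow_le hβ hb hα (4 * C) (ε := 1 / 1000)
    (by norm_num)
  refine ⟨a₀, ha₀, fun a ha q => ?_⟩
  have ha1 : (1 : ℝ) ≤ a := ha₀.le.trans ha
  have hx0 : 0 ≤ 4 * (C * mollScale β α a b q ^ (2 * α)) :=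
    mul_nonneg (by norm_num) (mul_nonneg hC (Real.rpow_nonneg (mollScale_pos ha1 q).le _))
  have hx : 4 * (C * mollScale β α a b q ^ (2 * α)) ≤ 1 / 1000 := by
    have := h a ha q
    linarith
  have habs : |4 * (C * mollScale β α a b q ^ (2 * α))| ≤ 1 := by
    rw [abs_of_nonneg hx0]
    linarith
  have key := Real.abs_exp_sub_one_le habs
  rw [abs_of_nonneg hx0] at key
  linarith [(le_abs_self _).trans key]

/-- `1 ≤ ℓ⁻¹` (`ℓ ≤ λ_q⁻¹ ≤ 1`), for `a, b ≥ 1`, `β, α ≥ 0`. [folklore] -/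
theorem one_le_mollScale_inv {β α a b : ℝ} (ha : 1 ≤ a) (hb : 1 ≤ b) (hβ : 0 ≤ β) (hα : 0 ≤ α)
    (q : ℕ) : 1 ≤ (mollScale β α a b q)⁻¹ := by
  have h1f : 1 ≤ freq a b q := le_trans (by linarith [Real.two_le_pi]) (two_pi_le_freq ha q)
  have hℓ : mollScale β α a b q ≤ 1 :=
    (mollScale_le_freq_inv ha hb hβ hα q).trans (inv_le_one_of_one_le₀ h1f)
  exact (one_le_inv₀ (mollScale_pos ha q)).2 hℓ

end Bridge

/-! ## The Mikado ball in the carrier -/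

section MikadoBall

/-- The Mikado ball `B̄_∞(Id, 1/10)` transported to the carrier `𝕃` (the compact set of matrix
arguments on which the potential `V` and its derivative are bounded). [cite: BuckmasterEtAl2018, §5.3 (choice of 𝒩)] -/
def mikadoBallCL : Set 𝕃 :=
  (LinearMap.toContinuousLinearMap matCL.toAlgEquiv.toLinearMap) ''
    Metric.closedBall (1 : 𝕄) mikadoRadius

/-- The transported Mikado ball is compact. [folklore] -/
theorem isCompact_mikadoBallCL : IsCompact mikadoBallCL :=
  (isCompact_closedBall _ _).image (LinearMap.toContinuousLinearMap matCL.toAlgEquiv.toLinearMap).continuous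

/-- Membership: `R̃ ∈ 𝒩 ⇒ (R̃ in the carrier) ∈ mikadoBallCL`. [folklore] -/
theorem stressCL_mem_mikadoBallCL {c : ℝ} {Rsl : 𝕋³ → Fin 3 → ℝ³} {Dsl : 𝕋³ → ℝ³} {y : ℝ³}
    (h : liftTildeR c Rsl Dsl y ∈ Metric.closedBall (1 : 𝕄) mikadoRadius) :
    stressCL c Rsl Dsl y ∈ mikadoBallCL := by
  refine ⟨liftTildeR c Rsl Dsl y, h, ?_⟩
  change matCL (liftTildeR c Rsl Dsl y) = stressCL c Rsl Dsl y
  rw [← matCL_symm_stressCL, matCL.apply_symm_apply]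

end MikadoBall

/-! ## Pointwise bounds on the ingredients under the standing hypotheses -/

section Ingredients

variable {P : Params} {S : Setting} {Nbar : ℕ} {Cin C₀ c₀ : ℝ} {Cη : ℕ → ℕ → ℝ}

/-- (2.19): `‖Dʲ(lift v̄_q(s))‖ ≤ C_in δ_q^{1/2} λ_q ℓ^{-N}` for `j ≤ N + 1`, `N ≤ N̄` (`C_in ≥ 0`,
`a ≥ 1`). [cite: BuckmasterEtAl2018, §2.5 (2.19)] -/
theorem PerturbationHypotheses.norm_iteratedFDeriv_lift_vbar_le (H : PerturbationHypotheses P S Nbar Cin C₀)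
    (hCin : 0 ≤ Cin) (ha : 1 ≤ P.a) {N : ℕ} (hN : N ≤ Nbar) {j : ℕ} (hj : j ≤ N + 1) {s : ℝ}
    (hs : s ∈ Icc 0 S.T) (y : ℝ³) :
    ‖iteratedFDeriv ℝ j (lift (S.vbar s)) y‖ ≤
      Cin * (Real.sqrt (amp P.β P.a P.b S.q) * freq P.a P.b S.q *
        mollScale P.β P.α P.a P.b S.q ^ (-(N : ℝ))) :=
  norm_iteratedFDeriv_lift_le_of_holder_le hj
    (mul_nonneg hCin (mul_nonneg (mul_nonneg (Real.sqrt_nonneg _) (freq_pos ha _).le)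
      (Real.rpow_nonneg (mollScale_pos ha _).le _))) (H.velocity N hN s hs) y

/-- (2.20): `‖Dʲ(lift R̊̄_q(s))‖ ≤ C_in δ_{q+1} ℓ^{-N+α}` for `j ≤ N ≤ N̄` (`C_in ≥ 0`, `a ≥ 1`).
[cite: BuckmasterEtAl2018, §2.5 (2.20)] -/
theorem PerturbationHypotheses.norm_iteratedFDeriv_lift_Rbar_le (H : PerturbationHypotheses P S Nbar Cin C₀)
    (hCin : 0 ≤ Cin) (ha : 1 ≤ P.a) {N : ℕ} (hN : N ≤ Nbar) {j : ℕ} (hj : j ≤ N) {s : ℝ}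
    (hs : s ∈ Icc 0 S.T) (y : ℝ³) :
    ‖iteratedFDeriv ℝ j (lift (S.Rbar s)) y‖ ≤
      Cin * (amp P.β P.a P.b (S.q + 1) * mollScale P.β P.α P.a P.b S.q ^ (-(N : ℝ) + P.α)) :=
  norm_iteratedFDeriv_lift_le_of_holder_le hj
    (mul_nonneg hCin (mul_nonneg (amp_pos ha _).le (Real.rpow_nonneg (mollScale_pos ha _).le _)))
    (H.stress N hN s hs) y

/-- Lemma 5.3 at order `(0,1)`: `|ηᵢ| ≤ 1` and `‖D(lift ηᵢ(t))‖ ≤ C_η(0,1)⁺` on `[0,T]`.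
[cite: BuckmasterEtAl2018, Lemma 5.3] -/
theorem PerturbationData.norm_fderiv_lift_eta_le (𝒟 : PerturbationData P S c₀ Cη) (i : ℕ) {t : ℝ}
    (ht : t ∈ Icc 0 S.T) (y : ℝ³) :
    |lift (𝒟.cut.η i t) y| ≤ 1 ∧ ‖fderiv ℝ (lift (𝒟.cut.η i t)) y‖ ≤ max (Cη 0 1) 0 := by
  refine ⟨?_, ?_⟩
  · rw [lift_apply, abs_of_nonneg (𝒟.cut.nonneg i t _)]
    exact 𝒟.cut.le_one i t _
  · have h := 𝒟.cut.deriv_le i 0 1 t ht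
    simp only [Function.iterate_zero, id_eq, Nat.cast_zero, neg_zero, Real.rpow_zero, mul_one] at h
    have h' : Torus.eContDiffHolderNorm 1 0 (𝒟.cut.η i t) ≤ ENNReal.ofReal (max (Cη 0 1) 0) :=
      h.trans (ENNReal.ofReal_le_ofReal (le_max_left _ _))
    have := norm_iteratedFDeriv_lift_le_of_holder_le le_rfl (le_max_right _ _) h' y
    rwa [norm_iteratedFDeriv_one_eq_norm_fderiv] at this

/-- `(ρ_q/∑∫η_j²)^{1/2} ≤ (δ_{q+1}/c₀)^{1/2}` on `[0,T]` (Lemma 5.4: `ρ_q ≤ δ_{q+1}`, `∑∫η_j² ≥ c₀`).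
[cite: BuckmasterEtAl2018, Lemma 5.4 (5.15)–(5.16)] -/
theorem PerturbationData.sqrt_rhoQ_div_etaMass_le (H : PerturbationHypotheses P S Nbar Cin C₀)
    (𝒟 : PerturbationData P S c₀ Cη) (hc₀ : 0 < c₀) (ha : 1 ≤ P.a) {t : ℝ} (ht : t ∈ Icc 0 S.T) :
    Real.sqrt (rhoQ P S t / etaMass P S 𝒟.cut.η t) ≤ Real.sqrt (amp P.β P.a P.b (S.q + 1) / c₀) := by
  have hm : c₀ ≤ etaMass P S 𝒟.cut.η t := 𝒟.le_etaMass ht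
  have hm0 : 0 < etaMass P S 𝒟.cut.η t := hc₀.trans_le hm
  refine Real.sqrt_le_sqrt ?_
  calc rhoQ P S t / etaMass P S 𝒟.cut.η t
      ≤ amp P.β P.a P.b (S.q + 1) / etaMass P S 𝒟.cut.η t :=
        div_le_div_of_nonneg_right (H.rhoQ_le ha ht) hm0.le
    _ ≤ amp P.β P.a P.b (S.q + 1) / c₀ := div_le_div_of_nonneg_left (amp_pos ha _).le hc₀ hm

/-- `0 ≤ ∑∫η_j²/ρ_q ≤ 8λ_q^α/δ_{q+1}` on `[0,T]`, given `4δ_{q+2} ≤ δ_{q+1}λ_q^{-α}` (Lemma 5.4: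
`ρ_q ≥ δ_{q+1}λ_q^{-α}/8`, `∑∫η_j² ≤ 1`). [cite: BuckmasterEtAl2018, Lemma 5.4 (5.15), (5.19)] -/
private theorem PerturbationData.etaMass_div_rhoQ_bounds (H : PerturbationHypotheses P S Nbar Cin C₀)
    (𝒟 : PerturbationData P S c₀ Cη) (ha : 1 ≤ P.a)
    (h4 : 4 * amp P.β P.a P.b (S.q + 2) ≤ amp P.β P.a P.b (S.q + 1) * freq P.a P.b S.q ^ (-P.α))
    {t : ℝ} (ht : t ∈ Icc 0 S.T) :
    0 ≤ etaMass P S 𝒟.cut.η t / rhoQ P S t ∧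
      etaMass P S 𝒟.cut.η t / rhoQ P S t ≤ 8 * freq P.a P.b S.q ^ P.α / amp P.β P.a P.b (S.q + 1) := by
  have hδ : 0 < amp P.β P.a P.b (S.q + 1) := amp_pos ha _
  have hfr : 0 < freq P.a P.b S.q ^ (-P.α) := Real.rpow_pos_of_pos (freq_pos ha _) _
  have hρ : amp P.β P.a P.b (S.q + 1) * freq P.a P.b S.q ^ (-P.α) / 8 ≤ rhoQ P S t := H.le_rhoQ h4 ht
  have hρ0 : 0 < rhoQ P S t := lt_of_lt_of_le (by positivity) hρ
  have hS1 : etaMass P S 𝒟.cut.η t ≤ 1 := 𝒟.etaMass_le_one ht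
  have hS0 : 0 ≤ etaMass P S 𝒟.cut.η t :=
    Finset.sum_nonneg fun j _ => integral_nonneg fun y => sq_nonneg _
  refine ⟨div_nonneg hS0 hρ0.le, ?_⟩
  rw [div_le_div_iff₀ hρ0 hδ]
  have h2 : 8 * freq P.a P.b S.q ^ P.α * (amp P.β P.a P.b (S.q + 1) * freq P.a P.b S.q ^ (-P.α) / 8) =
      amp P.β P.a P.b (S.q + 1) := by
    have : freq P.a P.b S.q ^ P.α * freq P.a P.b S.q ^ (-P.α) = 1 := by
      rw [← Real.rpow_add (freq_pos ha _), add_neg_cancel, Real.rpow_zero]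
    calc 8 * freq P.a P.b S.q ^ P.α * (amp P.β P.a P.b (S.q + 1) * freq P.a P.b S.q ^ (-P.α) / 8)
        = amp P.β P.a P.b (S.q + 1) * (freq P.a P.b S.q ^ P.α * freq P.a P.b S.q ^ (-P.α)) := by ring
      _ = _ := by rw [this, mul_one]
  calc etaMass P S 𝒟.cut.η t * amp P.β P.a P.b (S.q + 1) ≤ amp P.β P.a P.b (S.q + 1) := by nlinarith
    _ = 8 * freq P.a P.b S.q ^ P.α * (amp P.β P.a P.b (S.q + 1) * freq P.a P.b S.q ^ (-P.α) / 8) :=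
        h2.symm
    _ ≤ 8 * freq P.a P.b S.q ^ P.α * rhoQ P S t :=
        mul_le_mul_of_nonneg_left hρ (mul_nonneg (by norm_num) (Real.rpow_nonneg (freq_pos ha _).le _))

/-- **Deformation bounds on the support of the cut-offs** (Lemma 5.4 (5.14) and Prop. 5.7 (5.33)
at order one, via App. B (B.4)–(B.5) = `BDSV.norm_gradField_le`, `BDSV.norm_gradField_two_le`):
under the standing hypotheses with `N̄ ≥ 1` and the threshold `exp(4C_inℓ^{2α}) - 1 ≤ 1/300`, if
`ηᵢ(t, ·) ≠ 0` somewhere then `‖D(lift Dᵢ(t))‖ ≤ 1/300` and `‖D²(lift Dᵢ(t))‖ ≤ ℓ⁻¹` everywhere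
(`|t - tᵢ*| ≤ 4τ_q/3`, `C_in δ_q^{1/2}λ_q τ_q = C_in ℓ^{2α}`, `‖v̄_q‖₂ ≤ C_in δ_q^{1/2}λ_q ℓ⁻¹`).
[cite: BuckmasterEtAl2018, Lemma 5.4 (5.14) and Prop. 5.7 (5.33)] -/
theorem PerturbationData.norm_fderiv_lift_D_le (H : PerturbationHypotheses P S Nbar Cin C₀)
    (𝒟 : PerturbationData P S c₀ Cη) (hCin : 0 ≤ Cin) (ha : 1 ≤ P.a) (hNbar : 1 ≤ Nbar)
    (hdef : Real.exp (4 * (Cin * mollScale P.β P.α P.a P.b S.q ^ (2 * P.α))) - 1 ≤ 1 / 300)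
    {i : ℕ} {t : ℝ} (ht : t ∈ Icc 0 S.T) {x' : 𝕋³} (hη : 𝒟.cut.η i t x' ≠ 0) (y : ℝ³) :
    ‖fderiv ℝ (lift (𝒟.D i t)) y‖ ≤ 1 / 300 ∧
      ‖fderiv ℝ (fderiv ℝ (lift (𝒟.D i t))) y‖ ≤ (mollScale P.β P.α P.a P.b S.q)⁻¹ := by
  set ℓ := mollScale P.β P.α P.a P.b S.q with hℓdef
  have hℓ : 0 < ℓ := mollScale_pos ha _
  set K₁ : ℝ := Cin * (Real.sqrt (amp P.β P.a P.b S.q) * freq P.a P.b S.q) with hK₁def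
  have hK₁ : 0 ≤ K₁ := mul_nonneg hCin (mul_nonneg (Real.sqrt_nonneg _) (freq_pos ha _).le)
  have hK₂ : 0 ≤ K₁ * ℓ⁻¹ := mul_nonneg hK₁ (inv_nonneg.2 hℓ.le)
  -- bounds on `∇v̄`, `∇²v̄`
  have hb₁ : ∀ s ∈ Icc 0 S.T, ∀ x, ‖gradField S.vbar s x‖ ≤ K₁ := by
    refine forall_norm_gradField_le_of_lift fun s hs z => ?_
    have h := H.norm_iteratedFDeriv_lift_vbar_le hCin ha (N := 0) (Nat.zero_le _) (j := 1) le_rfl hs z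
    simp only [Nat.cast_zero, neg_zero, Real.rpow_zero, mul_one] at h
    exact h
  have hb₂ : ∀ s ∈ Icc 0 S.T, ∀ x, ‖gradField (gradField S.vbar) s x‖ ≤ K₁ * ℓ⁻¹ := by
    refine forall_norm_gradField_two_le_of_lift fun s hs z => ?_
    have h := H.norm_iteratedFDeriv_lift_vbar_le hCin ha (N := 1) hNbar (j := 2) le_rfl hs z
    rw [Nat.cast_one, Real.rpow_neg_one] at h
    rw [hK₁def, mul_assoc]
    exact h
  -- time localisation and the CFL-type condition
  have hτ : 0 < P.τ S.q := glueScale_pos ha S.q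
  have hanchor : min ((i : ℝ) * P.τ S.q) S.T ∈ Icc 0 S.T :=
    ⟨le_min (mul_nonneg i.cast_nonneg hτ.le) H.pos_T.le, min_le_right _ _⟩
  have hdt : |t - min ((i : ℝ) * P.τ S.q) S.T| ≤ 4 * P.τ S.q / 3 :=
    CutoffFamily.abs_sub_anchor_le hτ 𝒟.cut ht hη
  have hKτ : K₁ * P.τ S.q = Cin * ℓ ^ (2 * P.α) := velocityBound_mul_tau ha S.q
  have hCℓ : 4 * (Cin * ℓ ^ (2 * P.α)) ≤ 1 / 300 := by
    linarith [Real.add_one_le_exp (4 * (Cin * ℓ ^ (2 * P.α)))]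
  have hdtK : |t - min ((i : ℝ) * P.τ S.q) S.T| * K₁ ≤ 4 / 3 * (Cin * ℓ ^ (2 * P.α)) :=
    calc |t - min ((i : ℝ) * P.τ S.q) S.T| * K₁ ≤ 4 * P.τ S.q / 3 * K₁ :=
          mul_le_mul_of_nonneg_right hdt hK₁
      _ = 4 / 3 * (K₁ * P.τ S.q) := by ring
      _ = 4 / 3 * (Cin * ℓ ^ (2 * P.α)) := by rw [hKτ]
  have hCFL : |t - min ((i : ℝ) * P.τ S.q) S.T| * K₁ ≤ 1 := by linarith
  have htr := fun s (hs : s ∈ Icc 0 S.T) x => (𝒟.flow i).advectiveDeriv_eq hs x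
  have h1 := norm_gradField_le H.pos_T H.eulerReynolds.smooth_velocity (𝒟.flow i).smooth htr hanchor
    (𝒟.flow i).anchor hK₁ hb₁ ht hCFL (proj y)
  have h2 := norm_gradField_two_le H.pos_T H.eulerReynolds.smooth_velocity (𝒟.flow i).smooth htr
    hanchor (𝒟.flow i).anchor hK₁ hK₂ hb₁ hb₂ ht hCFL (proj y)
  refine ⟨?_, ?_⟩
  · rw [fderiv_lift]
    calc ‖Torus.fderiv (𝒟.D i t) (proj y)‖ ≤ 3 * K₁ * |t - min ((i : ℝ) * P.τ S.q) S.T| := h1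
      _ ≤ 1 / 300 := by nlinarith
  · rw [← norm_iteratedFDeriv_two_eq_norm_fderiv_fderiv, norm_iteratedFDeriv_lift_two]
    calc ‖Torus.fderiv (fun x => Torus.fderiv (𝒟.D i t) x) (proj y)‖
        ≤ 32 * (K₁ * ℓ⁻¹) * |t - min ((i : ℝ) * P.τ S.q) S.T| := h2
      _ = 32 * (|t - min ((i : ℝ) * P.τ S.q) S.T| * K₁) * ℓ⁻¹ := by ring
      _ ≤ 32 * (4 / 3 * (Cin * ℓ ^ (2 * P.α))) * ℓ⁻¹ := by gcongr
      _ ≤ ℓ⁻¹ := by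
          have : 0 ≤ ℓ⁻¹ := inv_nonneg.2 hℓ.le
          nlinarith

end Ingredients

/-! ## Sup bounds on `w_o` and `w_c` -/

section SupBounds

variable {P : Params} {S : Setting} {Nbar : ℕ} {Cin C₀ c₀ : ℝ} {Cη : ℕ → ℕ → ℝ}

/-- **The fast part is of size `n ρ^{1/2}`**: if `|η| ≤ 1`, `‖D(lift D)‖ ≤ 1` and
`‖D(mikadoLiftCL V)‖ ≤ C_V` at the point, then `‖fastDeriv‖ ≤ nσ · 4‖T‖C_V` (`σ, n ≥ 0`;
`‖∇Φ‖ ≤ 2`, `‖D_ξ V‖ ≤ C_V`). [cite: BuckmasterEtAl2018, Cor. 5.8 (5.29)] -/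
theorem norm_fastDeriv_le {V : 𝕄 → 𝕋³ → ℝ³} (hV : ContDiff ℝ ∞ (mikadoLift V)) {σ c n : ℝ}
    (hσ : 0 ≤ σ) (hn : 0 ≤ n) {ηsl : 𝕋³ → ℝ} {Rsl : 𝕋³ → Fin 3 → ℝ³} {Dsl : 𝕋³ → ℝ³} {y : ℝ³}
    {CV : ℝ} (he0 : |lift ηsl y| ≤ 1) (hd1 : ‖fderiv ℝ (lift Dsl) y‖ ≤ 1)
    (hV1 : ‖fderiv ℝ (mikadoLiftCL V) (stressCL c Rsl Dsl y, n • (y + lift Dsl y))‖ ≤ CV) :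
    ‖fastDeriv V σ c n ηsl Rsl Dsl y‖ ≤ n * σ * (4 * ‖transposeCL‖ * CV) := by
  have hCV : 0 ≤ CV := le_trans (norm_nonneg (fderiv ℝ (mikadoLiftCL V) _)) hV1
  set θ := ‖transposeCL‖ with hθdef
  have hθ : 0 ≤ θ := norm_nonneg transposeCL
  set G : 𝕃 := gradPhiCL Dsl y with hGdef
  have hGn : ‖G‖ ≤ 2 := by
    rw [hGdef, gradPhiCL]
    refine (norm_add_le _ _).trans ?_
    have := ContinuousLinearMap.norm_id_le (𝕜 := ℝ) (E := ℝ³)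
    rw [← ContinuousLinearMap.one_def] at this
    linarith
  have hAn : ‖transposeCL G‖ ≤ 2 * θ :=
    (transposeCL.le_opNorm G).trans (by rw [← hθdef, mul_comm]; exact mul_le_mul_of_nonneg_right hGn hθ)
  have hD₂ : ‖fderiv ℝ (lift (V (matCL.symm (stressCL c Rsl Dsl y)))) (n • (y + lift Dsl y))‖ ≤ CV := by
    rw [← fderiv_mikadoLiftCL_comp_inr hV]
    refine (ContinuousLinearMap.opNorm_comp_le _ _).trans ?_
    calc ‖fderiv ℝ (mikadoLiftCL V) (stressCL c Rsl Dsl y, n • (y + lift Dsl y))‖ *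
          ‖ContinuousLinearMap.inr ℝ 𝕃 ℝ³‖ ≤ CV * 1 :=
          mul_le_mul hV1 (ContinuousLinearMap.norm_inr_le_one ℝ 𝕃 ℝ³)
            (norm_nonneg (ContinuousLinearMap.inr ℝ 𝕃 ℝ³)) hCV
      _ = CV := mul_one _
  have hf : |n * (σ * lift ηsl y)| ≤ n * σ := by
    rw [abs_mul, abs_mul, abs_of_nonneg hn, abs_of_nonneg hσ]
    exact mul_le_mul_of_nonneg_left ((mul_le_mul_of_nonneg_left he0 hσ).trans (mul_one σ).le) hn
  rw [fastDeriv, norm_smul, Real.norm_eq_abs]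
  calc |n * (σ * lift ηsl y)| *
        ‖transposeCL G * fderiv ℝ (lift (V (matCL.symm (stressCL c Rsl Dsl y)))) (n • (y + lift Dsl y)) * G‖
      ≤ (n * σ) * (2 * θ * CV * 2) := by
        refine mul_le_mul hf ?_ (norm_nonneg _) (mul_nonneg hn hσ)
        exact (norm_mul_le _ _).trans (mul_le_mul ((norm_mul_le _ _).trans
          (mul_le_mul hAn hD₂ (norm_nonneg _) (by positivity))) hGn (norm_nonneg _) (by positivity))
    _ = n * σ * (4 * ‖transposeCL‖ * CV) := by rw [← hθdef]; ring

variable {𝔚 : MikadoDatum mikadoRadius} {η : ℕ → ℝ → 𝕋³ → ℝ} {D : ℕ → ℝ → 𝕋³ → ℝ³} {i : ℕ} {t : ℝ}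

/-- **`n w_{o,i} = curl[fast partᵢ]`** at a point `x = proj y` at which `R̃_{q,i}(x)` lies in the
Mikado ball whenever `ηᵢ(x) ≠ 0` (from `BDSV.curl_potentialSummand_proj` and
`BDSV.hasFDerivAt_summandCL`: the curl of the summand is `curl[fast] + curl[slow]`).
[cite: BuckmasterEtAl2018, §5.3 (5.20), (5.28)] -/
theorem smul_principalSummand_eq (hη : IsSmooth (η i t)) (hR : IsSmooth (S.Rbar t))
    (hD : IsSmooth (D i t)) (hsymm : ∀ x, ∀ a b : Fin 3, S.Rbar t x a b = S.Rbar t x b a) {y : ℝ³}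
    (hball : η i t (proj y) ≠ 0 →
      tildeR P S η D i t (proj y) ∈ Metric.closedBall (1 : 𝕄) mikadoRadius) :
    (P.freqNat (S.q + 1) : ℝ) •
        (sqrtRhoI P S η i t (proj y) •
          Matrix.toEuclideanLin (gradPhi D i t (proj y)).adjugate
            (𝔚.W (tildeR P S η D i t (proj y)) (P.freqNat (S.q + 1) • phiPoint D i t (proj y)))) =
      curlCLM (fastDeriv 𝔚.V (Real.sqrt (rhoQ P S t / etaMass P S η t)) (etaMass P S η t / rhoQ P S t)
        (P.freqNat (S.q + 1)) (η i t) (S.Rbar t) (D i t) y) := by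
  have h1 := curl_potentialSummand_proj (P := P) (S := S) (𝔚 := 𝔚) hη hR hD hsymm hball
  rw [curl_proj_eq ((isSmooth_potentialSummand hη hR hD).isContDiff (by simp)),
    lift_potentialSummand_eq_summandCL (hD.isContDiff (by simp)),
    (hasFDerivAt_summandCL 𝔚.contDiff_mikadoLift_V hη hR hD y).fderiv, map_add, slowPart] at h1
  exact (add_right_cancel h1).symm

/-- **The ingredient bounds at an active index** (`ηᵢ(t, proj y) ≠ 0`): `‖D(lift Dᵢ)‖ ≤ 1`,
`‖D²(lift Dᵢ)‖ ≤ ℓ⁻¹`, `R̃_{q,i}` in the Mikado ball (matrix and carrier form), and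
`‖DR̃_{q,i}‖ ≤ 9‖T‖ℓ⁻¹` ((5.32)–(5.33) with `‖∇R̊̄_q‖ ≤ C_inδ_{q+1}ℓ^{-1+α}`, `∑∫η²/ρ_q ≤ 8λ_q^α/δ_{q+1}`
and `800(1 + ‖ofCols‖)C_in(λ_qℓ)^α ≤ 1`). [cite: BuckmasterEtAl2018, Lemma 5.4 and Prop. 5.7 (5.32)–(5.33)] -/
theorem PerturbationData.active_bounds (H : PerturbationHypotheses P S Nbar Cin C₀)
    (𝒟 : PerturbationData P S c₀ Cη) (hCin : 0 ≤ Cin) (ha : 1 ≤ P.a) (hNbar : 1 ≤ Nbar)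
    (h4 : 4 * amp P.β P.a P.b (S.q + 2) ≤ amp P.β P.a P.b (S.q + 1) * freq P.a P.b S.q ^ (-P.α))
    (hdef : Real.exp (4 * (Cin * mollScale P.β P.α P.a P.b S.q ^ (2 * P.α))) - 1 ≤ 1 / 300)
    (hstr : 800 * (1 + ‖ofColsCL‖) * Cin *
      (freq P.a P.b S.q ^ P.α * mollScale P.β P.α P.a P.b S.q ^ P.α) ≤ 1)
    {i : ℕ} {t : ℝ} (ht : t ∈ Icc 0 S.T) {y : ℝ³} (hη : 𝒟.cut.η i t (proj y) ≠ 0) :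
    ‖fderiv ℝ (lift (𝒟.D i t)) y‖ ≤ 1 ∧
    ‖fderiv ℝ (fderiv ℝ (lift (𝒟.D i t))) y‖ ≤ (mollScale P.β P.α P.a P.b S.q)⁻¹ ∧
    tildeR P S 𝒟.cut.η 𝒟.D i t (proj y) ∈ Metric.closedBall (1 : 𝕄) mikadoRadius ∧
    stressCL (etaMass P S 𝒟.cut.η t / rhoQ P S t) (S.Rbar t) (𝒟.D i t) y ∈ mikadoBallCL ∧
    ‖fderiv ℝ (stressCL (etaMass P S 𝒟.cut.η t / rhoQ P S t) (S.Rbar t) (𝒟.D i t)) y‖ ≤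
      9 * ‖transposeCL‖ * (mollScale P.β P.α P.a P.b S.q)⁻¹ := by
  set ℓ := mollScale P.β P.α P.a P.b S.q with hℓdef
  have hℓ : 0 < ℓ := mollScale_pos ha _
  have hℓi : 0 ≤ ℓ⁻¹ := inv_nonneg.2 hℓ.le
  set X : ℝ := freq P.a P.b S.q ^ P.α * ℓ ^ P.α with hXdef
  have hX : 0 ≤ X := mul_nonneg (Real.rpow_nonneg (freq_pos ha _).le _) (Real.rpow_nonneg hℓ.le _)
  set o : ℝ := ‖ofColsCL‖ with hodef
  have ho : 0 ≤ o := norm_nonneg ofColsCL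
  set θ : ℝ := ‖transposeCL‖ with hθdef
  have hθ : 0 ≤ θ := norm_nonneg transposeCL
  -- consequences of the stress threshold
  have hCX : Cin * X ≤ (1 + o) * (Cin * X) := le_mul_of_one_le_left (mul_nonneg hCin hX) (by linarith)
  have hstr' : 8 * (Cin * X) ≤ 1 / 100 := by nlinarith
  have hoX : 8 * o * Cin * X ≤ 1 / 100 := by nlinarith [mul_nonneg ho (mul_nonneg hCin hX)]
  -- the deformation bounds
  obtain ⟨hd1, hd2⟩ := 𝒟.norm_fderiv_lift_D_le H hCin ha hNbar hdef ht hη y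
  have hd1' : ‖fderiv ℝ (lift (𝒟.D i t)) y‖ ≤ 1 := hd1.trans (by norm_num)
  -- the Mikado ball
  have hballR : tildeR P S 𝒟.cut.η 𝒟.D i t (proj y) ∈ Metric.closedBall (1 : 𝕄) mikadoRadius :=
    𝒟.tildeR_mem_closedBall H hCin ha hdef hstr' h4 ht hη (proj y)
  have hDs : IsSmooth (𝒟.D i t) := (𝒟.flow i).smooth.isSmooth_slice ht
  have hRs : IsSmooth (S.Rbar t) := H.eulerReynolds.smooth_stress.isSmooth_slice ht
  have hD1 : IsContDiff 1 (𝒟.D i t) := hDs.isContDiff (by simp)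
  have hlt : liftTildeR (etaMass P S 𝒟.cut.η t / rhoQ P S t) (S.Rbar t) (𝒟.D i t) y =
      tildeR P S 𝒟.cut.η 𝒟.D i t (proj y) := by
    have h := congrFun (lift_tildeR (P := P) (S := S) (η := 𝒟.cut.η) (D := 𝒟.D) (i := i) (t := t) hD1) y
    rw [lift_apply] at h
    exact h.symm
  have hK : stressCL (etaMass P S 𝒟.cut.η t / rhoQ P S t) (S.Rbar t) (𝒟.D i t) y ∈ mikadoBallCL :=
    stressCL_mem_mikadoBallCL (hlt ▸ hballR)
  -- the derivative of `R̃`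
  obtain ⟨hc0, hc⟩ := 𝒟.etaMass_div_rhoQ_bounds H ha h4 ht
  have hδ : 0 < amp P.β P.a P.b (S.q + 1) := amp_pos ha _
  have hr0 : ‖lift (S.Rbar t) y‖ ≤ Cin * (amp P.β P.a P.b (S.q + 1) * ℓ ^ P.α) := by
    have h := H.norm_iteratedFDeriv_lift_Rbar_le hCin ha (N := 0) (Nat.zero_le _) (j := 0) le_rfl ht y
    simp only [Nat.cast_zero, neg_zero, zero_add, norm_iteratedFDeriv_zero] at h
    exact h
  have hr1 : ‖iteratedFDeriv ℝ 1 (lift (S.Rbar t)) y‖ ≤ Cin * (amp P.β P.a P.b (S.q + 1) * ℓ ^ (-1 + P.α)) := by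
    have h := H.norm_iteratedFDeriv_lift_Rbar_le hCin ha (N := 1) hNbar (j := 1) le_rfl ht y
    rw [Nat.cast_one] at h
    exact h
  have hcr0 : |etaMass P S 𝒟.cut.η t / rhoQ P S t| * o * ‖lift (S.Rbar t) y‖ ≤ 1 := by
    rw [abs_of_nonneg hc0]
    calc etaMass P S 𝒟.cut.η t / rhoQ P S t * o * ‖lift (S.Rbar t) y‖
        ≤ (8 * freq P.a P.b S.q ^ P.α / amp P.β P.a P.b (S.q + 1)) * o *
            (Cin * (amp P.β P.a P.b (S.q + 1) * ℓ ^ P.α)) :=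
          mul_le_mul (mul_le_mul_of_nonneg_right hc ho) hr0 (norm_nonneg _)
            (mul_nonneg (div_nonneg (mul_nonneg (by norm_num) (Real.rpow_nonneg (freq_pos ha _).le _)) hδ.le) ho)
      _ = 8 * o * Cin * X := by rw [hXdef]; field_simp
      _ ≤ 1 := hoX.trans (by norm_num)
  have hcr1 : |etaMass P S 𝒟.cut.η t / rhoQ P S t| * o * ‖iteratedFDeriv ℝ 1 (lift (S.Rbar t)) y‖ ≤
      1 / 100 * ℓ⁻¹ := by
    rw [abs_of_nonneg hc0]
    calc etaMass P S 𝒟.cut.η t / rhoQ P S t * o * ‖iteratedFDeriv ℝ 1 (lift (S.Rbar t)) y‖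
        ≤ (8 * freq P.a P.b S.q ^ P.α / amp P.β P.a P.b (S.q + 1)) * o *
            (Cin * (amp P.β P.a P.b (S.q + 1) * ℓ ^ (-1 + P.α))) :=
          mul_le_mul (mul_le_mul_of_nonneg_right hc ho) hr1 (norm_nonneg _)
            (mul_nonneg (div_nonneg (mul_nonneg (by norm_num) (Real.rpow_nonneg (freq_pos ha _).le _)) hδ.le) ho)
      _ = 8 * o * Cin * X * ℓ⁻¹ := by
          rw [hXdef, Real.rpow_add hℓ, Real.rpow_neg_one]
          field_simp
      _ ≤ 1 / 100 * ℓ⁻¹ := mul_le_mul_of_nonneg_right hoX hℓi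
  have hst := (norm_iteratedFDeriv_stressCL_le (etaMass P S 𝒟.cut.η t / rhoQ P S t) hRs hDs y
    (by rw [norm_iteratedFDeriv_one_eq_norm_fderiv]; exact hd1') hcr0).1
  rw [norm_iteratedFDeriv_one_eq_norm_fderiv, norm_iteratedFDeriv_two_eq_norm_fderiv_fderiv] at hst
  refine ⟨hd1', hd2, hballR, hK, hst.trans ?_⟩
  rw [← hθdef, ← hodef]
  calc θ * (8 * ‖fderiv ℝ (fderiv ℝ (lift (𝒟.D i t))) y‖ +
        4 * (|etaMass P S 𝒟.cut.η t / rhoQ P S t| * o * ‖iteratedFDeriv ℝ 1 (lift (S.Rbar t)) y‖))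
      ≤ θ * (8 * ℓ⁻¹ + 4 * (1 / 100 * ℓ⁻¹)) := by gcongr
    _ ≤ 9 * θ * ℓ⁻¹ := by nlinarith [mul_nonneg hθ hℓi]

/-- `n_{q+1} > 0` for `a ≥ 1`. [folklore] -/
theorem Params.freqNat_pos (P : Params) (ha : 1 ≤ P.a) (q : ℕ) : 0 < P.freqNat q :=
  Nat.ceil_pos.2 (Real.rpow_pos_of_pos (by linarith) _)

/-- **Sup bound on the principal part** (Cor. 5.8 (5.29) in crude form:
`‖w_o(x,t)‖ ≤ 4‖curl‖‖T‖C_V (δ_{q+1}/c₀)^{1/2}` — at most one cut-off is active, and for it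
`n w_{o,i} = curl[fastᵢ]` with `‖fastᵢ‖ ≤ 4n‖T‖C_V ρ_{q,i}^{1/2}`, `ρ_{q,i}^{1/2} ≤ (δ_{q+1}/c₀)^{1/2}`).
[cite: BuckmasterEtAl2018, Cor. 5.8 (5.29)] -/
theorem PerturbationData.principalPart_sup_le (H : PerturbationHypotheses P S Nbar Cin C₀)
    (𝒟 : PerturbationData P S c₀ Cη) (𝔚 : MikadoDatum mikadoRadius) (hc₀ : 0 < c₀) (hCin : 0 ≤ Cin)
    (ha : 1 ≤ P.a) (hNbar : 1 ≤ Nbar)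
    (h4 : 4 * amp P.β P.a P.b (S.q + 2) ≤ amp P.β P.a P.b (S.q + 1) * freq P.a P.b S.q ^ (-P.α))
    (hdef : Real.exp (4 * (Cin * mollScale P.β P.α P.a P.b S.q ^ (2 * P.α))) - 1 ≤ 1 / 300)
    (hstr : 800 * (1 + ‖ofColsCL‖) * Cin *
      (freq P.a P.b S.q ^ P.α * mollScale P.β P.α P.a P.b S.q ^ P.α) ≤ 1)
    {CV : ℝ} (hCV0 : 0 ≤ CV)
    (hCV : ∀ m ≤ 1, ∀ T ∈ mikadoBallCL, ∀ ξ : ℝ³, ‖iteratedFDeriv ℝ m (mikadoLiftCL 𝔚.V) (T, ξ)‖ ≤ CV)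
    {t : ℝ} (ht : t ∈ Icc 0 S.T) (x : 𝕋³) :
    ‖principalPart P S 𝔚 𝒟.cut.η 𝒟.D t x‖ ≤
      4 * ‖curlCLM‖ * ‖transposeCL‖ * CV * Real.sqrt (amp P.β P.a P.b (S.q + 1) / c₀) := by
  obtain ⟨y, rfl⟩ := proj_surjective x
  set B := 4 * ‖curlCLM‖ * ‖transposeCL‖ * CV * Real.sqrt (amp P.β P.a P.b (S.q + 1) / c₀) with hBdef
  have hKc : 0 ≤ ‖curlCLM‖ := norm_nonneg curlCLM
  have hθ : 0 ≤ ‖transposeCL‖ := norm_nonneg transposeCL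
  have hB0 : 0 ≤ B := by positivity
  have hn0 : (0 : ℝ) < P.freqNat (S.q + 1) := Nat.cast_pos.2 (P.freqNat_pos ha _)
  have hηs : ∀ j, IsSmooth (𝒟.cut.η j t) := fun j => (𝒟.cut.smooth j).isSmooth_slice ht
  have hRs : IsSmooth (S.Rbar t) := H.eulerReynolds.smooth_stress.isSmooth_slice ht
  have hDs : ∀ j, IsSmooth (𝒟.D j t) := fun j => (𝒟.flow j).smooth.isSmooth_slice ht
  have hsymm := H.eulerReynolds.symm t ht
  have hσ0 : 0 ≤ Real.sqrt (rhoQ P S t / etaMass P S 𝒟.cut.η t) := Real.sqrt_nonneg _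
  have hσ := 𝒟.sqrt_rhoQ_div_etaMass_le H hc₀ ha ht
  rw [principalPart]
  refine 𝒟.cut.norm_sum_le t (proj y) hB0 (fun j hj0 => by rw [sqrtRhoI, hj0, zero_mul, zero_smul])
    (fun j => ?_) _
  by_cases hne : 𝒟.cut.η j t (proj y) = 0
  · rw [sqrtRhoI, hne, zero_mul, zero_smul, norm_zero]
    exact hB0
  · obtain ⟨hd1, -, hballR, hK, -⟩ := 𝒟.active_bounds H hCin ha hNbar h4 hdef hstr ht hne
    have he := 𝒟.norm_fderiv_lift_eta_le j ht y
    have hV1 : ‖fderiv ℝ (mikadoLiftCL 𝔚.V) (stressCL (etaMass P S 𝒟.cut.η t / rhoQ P S t) (S.Rbar t)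
        (𝒟.D j t) y, (P.freqNat (S.q + 1) : ℝ) • (y + lift (𝒟.D j t) y))‖ ≤ CV := by
      have h := hCV 1 le_rfl _ hK ((P.freqNat (S.q + 1) : ℝ) • (y + lift (𝒟.D j t) y))
      rwa [norm_iteratedFDeriv_one_eq_norm_fderiv] at h
    have hid := smul_principalSummand_eq (P := P) (S := S) (𝔚 := 𝔚) (hηs j) hRs (hDs j) hsymm
      (fun _ => hballR)
    have hfast := norm_fastDeriv_le 𝔚.contDiff_mikadoLift_V hσ0 hn0.le he.1 hd1 hV1
    rw [← inv_smul_smul₀ hn0.ne' (sqrtRhoI P S 𝒟.cut.η j t (proj y) • _), hid, norm_smul, norm_inv,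
      Real.norm_natCast]
    calc ((P.freqNat (S.q + 1) : ℝ))⁻¹ * ‖curlCLM (fastDeriv 𝔚.V (Real.sqrt (rhoQ P S t / etaMass P S 𝒟.cut.η t))
          (etaMass P S 𝒟.cut.η t / rhoQ P S t) (P.freqNat (S.q + 1)) (𝒟.cut.η j t) (S.Rbar t) (𝒟.D j t) y)‖
        ≤ ((P.freqNat (S.q + 1) : ℝ))⁻¹ * (‖curlCLM‖ * ((P.freqNat (S.q + 1) : ℝ) *
            Real.sqrt (rhoQ P S t / etaMass P S 𝒟.cut.η t) * (4 * ‖transposeCL‖ * CV))) :=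
          mul_le_mul_of_nonneg_left ((curlCLM.le_opNorm _).trans (mul_le_mul_of_nonneg_left hfast hKc))
            (inv_nonneg.2 hn0.le)
      _ = 4 * ‖curlCLM‖ * ‖transposeCL‖ * CV * Real.sqrt (rhoQ P S t / etaMass P S 𝒟.cut.η t) := by
          field_simp
      _ ≤ B := by rw [hBdef]; gcongr

/-- **Sup bound on the corrector** (Cor. 5.8 (5.30) in crude form): with `w_c = n⁻¹∑ᵢ curl[slowᵢ]`
(`BDSV.correctorPart_proj`), at most one active cut-off, and the bound on the slow part
(`BDSV.norm_slowDeriv_le` with `‖DR̃‖ ≤ 9‖T‖ℓ⁻¹`, `‖D²Φ‖ ≤ ℓ⁻¹`, `‖Dη‖ ≤ C_η⁺ ≤ C_η⁺ℓ⁻¹`):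
`‖w_c(x,t)‖ ≤ 2π‖curl‖‖T‖C_V(18‖T‖ + 1 + 2C_η⁺)(δ_{q+1}/c₀)^{1/2} ℓ⁻¹ λ_{q+1}⁻¹` (`n⁻¹ = 2π/λ_{q+1}`).
[cite: BuckmasterEtAl2018, Cor. 5.8 (5.30)] -/
theorem PerturbationData.correctorPart_sup_le (H : PerturbationHypotheses P S Nbar Cin C₀)
    (𝒟 : PerturbationData P S c₀ Cη) (𝔚 : MikadoDatum mikadoRadius) (hc₀ : 0 < c₀) (hCin : 0 ≤ Cin)
    (ha : 1 ≤ P.a) (hb : 1 ≤ P.b) (hβ : 0 ≤ P.β) (hα : 0 ≤ P.α) (hNbar : 1 ≤ Nbar)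
    (h4 : 4 * amp P.β P.a P.b (S.q + 2) ≤ amp P.β P.a P.b (S.q + 1) * freq P.a P.b S.q ^ (-P.α))
    (hdef : Real.exp (4 * (Cin * mollScale P.β P.α P.a P.b S.q ^ (2 * P.α))) - 1 ≤ 1 / 300)
    (hstr : 800 * (1 + ‖ofColsCL‖) * Cin *
      (freq P.a P.b S.q ^ P.α * mollScale P.β P.α P.a P.b S.q ^ P.α) ≤ 1)
    {CV : ℝ} (hCV0 : 0 ≤ CV)
    (hCV : ∀ m ≤ 1, ∀ T ∈ mikadoBallCL, ∀ ξ : ℝ³, ‖iteratedFDeriv ℝ m (mikadoLiftCL 𝔚.V) (T, ξ)‖ ≤ CV)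
    {t : ℝ} (ht : t ∈ Icc 0 S.T) (x : 𝕋³) :
    ‖correctorPart P S 𝔚 𝒟.cut.η 𝒟.D t x‖ ≤
      2 * Real.pi * ‖curlCLM‖ * ‖transposeCL‖ * CV * (18 * ‖transposeCL‖ + 1 + 2 * max (Cη 0 1) 0) *
        (Real.sqrt (amp P.β P.a P.b (S.q + 1) / c₀) * (mollScale P.β P.α P.a P.b S.q)⁻¹ *
          (freq P.a P.b (S.q + 1))⁻¹) := by
  obtain ⟨y, rfl⟩ := proj_surjective x
  set ℓ := mollScale P.β P.α P.a P.b S.q with hℓdef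
  have hℓ : 0 < ℓ := mollScale_pos ha _
  have hℓ1 : 1 ≤ ℓ⁻¹ := one_le_mollScale_inv ha hb hβ hα S.q
  set θ : ℝ := ‖transposeCL‖ with hθdef
  have hθ : 0 ≤ θ := norm_nonneg transposeCL
  set Kc : ℝ := ‖curlCLM‖ with hKcdef
  have hKc : 0 ≤ Kc := norm_nonneg curlCLM
  set Cηp : ℝ := max (Cη 0 1) 0 with hCηpdef
  have hCηp : 0 ≤ Cηp := le_max_right _ _
  set σ' : ℝ := Real.sqrt (amp P.β P.a P.b (S.q + 1) / c₀) with hσ'def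
  have hσ'0 : 0 ≤ σ' := Real.sqrt_nonneg _
  set B : ℝ := Kc * (θ * CV * (18 * θ + 1 + 2 * Cηp) * (σ' * ℓ⁻¹)) with hBdef
  have hB0 : 0 ≤ B := by positivity
  have hn0 : (0 : ℝ) < P.freqNat (S.q + 1) := Nat.cast_pos.2 (P.freqNat_pos ha _)
  have hηs : ∀ j, IsSmooth (𝒟.cut.η j t) := fun j => (𝒟.cut.smooth j).isSmooth_slice ht
  have hRs : IsSmooth (S.Rbar t) := H.eulerReynolds.smooth_stress.isSmooth_slice ht
  have hDs : ∀ j, IsSmooth (𝒟.D j t) := fun j => (𝒟.flow j).smooth.isSmooth_slice ht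
  have hsymm := H.eulerReynolds.symm t ht
  have hσ0 : 0 ≤ Real.sqrt (rhoQ P S t / etaMass P S 𝒟.cut.η t) := Real.sqrt_nonneg _
  have hσ := 𝒟.sqrt_rhoQ_div_etaMass_le H hc₀ ha ht
  have hball : ∀ j, 𝒟.cut.η j t (proj y) ≠ 0 →
      tildeR P S 𝒟.cut.η 𝒟.D j t (proj y) ∈ Metric.closedBall (1 : 𝕄) mikadoRadius :=
    fun j hne => (𝒟.active_bounds H hCin ha hNbar h4 hdef hstr ht hne).2.2.1
  have hzero : ∀ j, 𝒟.cut.η j t (proj y) = 0 → curlCLM (slowPart P S 𝔚 𝒟.cut.η 𝒟.D j t y) = 0 := by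
    intro j hj0
    have hy : lift (𝒟.cut.η j t) y = 0 := by rw [lift_apply]; exact hj0
    rw [slowPart, slowDeriv_eq_zero hy (fderiv_lift_eq_zero_of_nonneg (𝒟.cut.nonneg j t) hy), map_zero]
  have hsum : ‖∑ j ∈ Finset.range (cutoffCount S.T (P.τ S.q)), curlCLM (slowPart P S 𝔚 𝒟.cut.η 𝒟.D j t y)‖ ≤ B := by
    refine 𝒟.cut.norm_sum_le t (proj y) hB0 hzero (fun j => ?_) _
    by_cases hne : 𝒟.cut.η j t (proj y) = 0
    · rw [hzero j hne, norm_zero]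
      exact hB0
    · obtain ⟨hd1, hd2, -, hK, ht1⟩ := 𝒟.active_bounds H hCin ha hNbar h4 hdef hstr ht hne
      have he := 𝒟.norm_fderiv_lift_eta_le j ht y
      have hV0 : ‖mikadoLiftCL 𝔚.V (stressCL (etaMass P S 𝒟.cut.η t / rhoQ P S t) (S.Rbar t)
          (𝒟.D j t) y, (P.freqNat (S.q + 1) : ℝ) • (y + lift (𝒟.D j t) y))‖ ≤ CV := by
        have h := hCV 0 zero_le_one _ hK ((P.freqNat (S.q + 1) : ℝ) • (y + lift (𝒟.D j t) y))
        rwa [norm_iteratedFDeriv_zero] at h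
      have hV1 : ‖fderiv ℝ (mikadoLiftCL 𝔚.V) (stressCL (etaMass P S 𝒟.cut.η t / rhoQ P S t) (S.Rbar t)
          (𝒟.D j t) y, (P.freqNat (S.q + 1) : ℝ) • (y + lift (𝒟.D j t) y))‖ ≤ CV := by
        have h := hCV 1 le_rfl _ hK ((P.freqNat (S.q + 1) : ℝ) • (y + lift (𝒟.D j t) y))
        rwa [norm_iteratedFDeriv_one_eq_norm_fderiv] at h
      have hslow := norm_slowDeriv_le (V := 𝔚.V) (c := etaMass P S 𝒟.cut.η t / rhoQ P S t)
        (n := (P.freqNat (S.q + 1) : ℝ)) hσ0 he.1 he.2 hd1 hd2 ht1 hV0 hV1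
      have hCV0' : 0 ≤ θ * CV := mul_nonneg hθ hCV0
      calc ‖curlCLM (slowPart P S 𝔚 𝒟.cut.η 𝒟.D j t y)‖
          ≤ Kc * ‖slowPart P S 𝔚 𝒟.cut.η 𝒟.D j t y‖ := curlCLM.le_opNorm _
        _ ≤ Kc * (Real.sqrt (rhoQ P S t / etaMass P S 𝒟.cut.η t) * θ * CV *
              (2 * (9 * θ * ℓ⁻¹) + ℓ⁻¹ + 2 * Cηp)) := mul_le_mul_of_nonneg_left hslow hKc
        _ ≤ Kc * (σ' * θ * CV * (2 * (9 * θ * ℓ⁻¹) + ℓ⁻¹ + 2 * (Cηp * ℓ⁻¹))) := by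
            refine mul_le_mul_of_nonneg_left ?_ hKc
            refine mul_le_mul (by gcongr) ?_ (by positivity) (by positivity)
            nlinarith [mul_nonneg hCηp (sub_nonneg.2 hℓ1)]
        _ = B := by rw [hBdef]; ring
  have hninv : ((P.freqNat (S.q + 1) : ℝ))⁻¹ = 2 * Real.pi * (freq P.a P.b (S.q + 1))⁻¹ := by
    rw [P.freq_eq (by linarith) (S.q + 1)]
    field_simp
  rw [correctorPart_proj hηs hRs hDs hsymm (P.freqNat_pos ha _).ne' hball, norm_smul, norm_inv,
    Real.norm_natCast, hninv]
  calc 2 * Real.pi * (freq P.a P.b (S.q + 1))⁻¹ *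
        ‖∑ j ∈ Finset.range (cutoffCount S.T (P.τ S.q)), curlCLM (slowPart P S 𝔚 𝒟.cut.η 𝒟.D j t y)‖
      ≤ 2 * Real.pi * (freq P.a P.b (S.q + 1))⁻¹ * B :=
        mul_le_mul_of_nonneg_left hsum (mul_nonneg (by positivity) (inv_nonneg.2 (freq_pos ha _).le))
    _ = _ := by rw [hBdef]; ring

end SupBounds

/-! ## The discharge of G₂ -/

section Discharge

variable {P : Params} {S : Setting} {Nbar : ℕ} {Cin C₀ c₀ : ℝ} {Cη : ℕ → ℕ → ℝ}

/-- **The corrector terms of the energy at fixed parameters** (the second estimate of the proof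
of Prop. 6.2): with `‖w_o‖₀ ≤ C_o δ_{q+1}^{1/2}` and `‖w_c‖₀ ≤ C_c δ_{q+1}^{1/2}ℓ⁻¹λ_{q+1}⁻¹`,
`|∫ 2w_o·w_c + |w_c|²| = |∫⟪2w_o + w_c, w_c⟫| ≤ (2C_o C_c + C_c²) δ_{q+1} ℓ⁻¹ λ_{q+1}⁻¹`, using
(6.6) `ℓλ_{q+1} ≥ 1`. Here `C_o = 4KθC_V/√c₀`, `C_c = 2πKθC_V(18θ + 1 + 2C_η⁺)/√c₀`
(`K = ‖curlCLM‖`, `θ = ‖transposeCL‖`). [cite: BuckmasterEtAl2018, Prop. 6.2 (proof, estimate of ∫ 2w_o·w_c + |w_c|²)] -/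
theorem PerturbationData.abs_integral_corrector_le (H : PerturbationHypotheses P S Nbar Cin C₀)
    (𝒟 : PerturbationData P S c₀ Cη) (𝔚 : MikadoDatum mikadoRadius) (hc₀ : 0 < c₀) (hCin : 0 ≤ Cin)
    (ha : 1 ≤ P.a) (hb : 1 ≤ P.b) (hβ : 0 ≤ P.β) (hα : 0 ≤ P.α) (hNbar : 1 ≤ Nbar)
    (h4 : 4 * amp P.β P.a P.b (S.q + 2) ≤ amp P.β P.a P.b (S.q + 1) * freq P.a P.b S.q ^ (-P.α))
    (hdef : Real.exp (4 * (Cin * mollScale P.β P.α P.a P.b S.q ^ (2 * P.α))) - 1 ≤ 1 / 300)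
    (hstr : 800 * (1 + ‖ofColsCL‖) * Cin *
      (freq P.a P.b S.q ^ P.α * mollScale P.β P.α P.a P.b S.q ^ P.α) ≤ 1)
    (hℓf : 1 ≤ mollScale P.β P.α P.a P.b S.q * freq P.a P.b (S.q + 1))
    {CV : ℝ} (hCV0 : 0 ≤ CV)
    (hCV : ∀ m ≤ 1, ∀ T ∈ mikadoBallCL, ∀ ξ : ℝ³, ‖iteratedFDeriv ℝ m (mikadoLiftCL 𝔚.V) (T, ξ)‖ ≤ CV)
    {t : ℝ} (ht : t ∈ Icc 0 S.T) :
    |∫ x, (2 * ⟪principalPart P S 𝔚 𝒟.cut.η 𝒟.D t x, correctorPart P S 𝔚 𝒟.cut.η 𝒟.D t x⟫_ℝ +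
        ‖correctorPart P S 𝔚 𝒟.cut.η 𝒟.D t x‖ ^ 2)| ≤
      (2 * (4 * ‖curlCLM‖ * ‖transposeCL‖ * CV / Real.sqrt c₀) *
          (2 * Real.pi * ‖curlCLM‖ * ‖transposeCL‖ * CV * (18 * ‖transposeCL‖ + 1 + 2 * max (Cη 0 1) 0) /
            Real.sqrt c₀) +
        (2 * Real.pi * ‖curlCLM‖ * ‖transposeCL‖ * CV * (18 * ‖transposeCL‖ + 1 + 2 * max (Cη 0 1) 0) /
            Real.sqrt c₀) ^ 2) *
      (amp P.β P.a P.b (S.q + 1) * (mollScale P.β P.α P.a P.b S.q)⁻¹ * (freq P.a P.b (S.q + 1))⁻¹) := by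
  set Co : ℝ := 4 * ‖curlCLM‖ * ‖transposeCL‖ * CV / Real.sqrt c₀ with hCodef
  set Cc : ℝ := 2 * Real.pi * ‖curlCLM‖ * ‖transposeCL‖ * CV * (18 * ‖transposeCL‖ + 1 + 2 * max (Cη 0 1) 0) /
    Real.sqrt c₀ with hCcdef
  set ℓ := mollScale P.β P.α P.a P.b S.q with hℓdef
  set lam := freq P.a P.b (S.q + 1) with hlamdef
  set s := Real.sqrt (amp P.β P.a P.b (S.q + 1)) with hsdef
  have hℓ : 0 < ℓ := mollScale_pos ha _
  have hlam : 0 < lam := freq_pos ha _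
  have hsc : 0 < Real.sqrt c₀ := Real.sqrt_pos.2 hc₀
  have hKc : 0 ≤ ‖curlCLM‖ := norm_nonneg curlCLM
  have hθ : 0 ≤ ‖transposeCL‖ := norm_nonneg transposeCL
  have hCηp : 0 ≤ max (Cη 0 1) 0 := le_max_right _ _
  have hCo : 0 ≤ Co :=
    div_nonneg (mul_nonneg (mul_nonneg (mul_nonneg (by norm_num) hKc) hθ) hCV0) hsc.le
  have hCc : 0 ≤ Cc :=
    div_nonneg (mul_nonneg (mul_nonneg (mul_nonneg (mul_nonneg (by positivity) hKc) hθ) hCV0)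
      (by nlinarith)) hsc.le
  have hs0 : 0 ≤ s := Real.sqrt_nonneg _
  have hsq : Real.sqrt (amp P.β P.a P.b (S.q + 1) / c₀) = s / Real.sqrt c₀ := Real.sqrt_div (amp_pos ha _).le c₀
  -- the two sup bounds, in the form `C_o s`, `C_c s u`
  set u : ℝ := ℓ⁻¹ * lam⁻¹ with hudef
  have hu0 : 0 ≤ u := mul_nonneg (inv_nonneg.2 hℓ.le) (inv_nonneg.2 hlam.le)
  have hu1 : u ≤ 1 := by
    rw [hudef, ← mul_inv, inv_le_one_iff₀]
    exact Or.inr hℓf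
  have hwo : ∀ x, ‖principalPart P S 𝔚 𝒟.cut.η 𝒟.D t x‖ ≤ Co * s := fun x => by
    have h := 𝒟.principalPart_sup_le H 𝔚 hc₀ hCin ha hNbar h4 hdef hstr hCV0 hCV ht x
    rw [hsq] at h
    refine h.trans (le_of_eq ?_)
    rw [hCodef, div_eq_mul_inv, div_eq_mul_inv]
    ring
  have hwc : ∀ x, ‖correctorPart P S 𝔚 𝒟.cut.η 𝒟.D t x‖ ≤ Cc * (s * u) := fun x => by
    have h := 𝒟.correctorPart_sup_le H 𝔚 hc₀ hCin ha hb hβ hα hNbar h4 hdef hstr hCV0 hCV ht x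
    rw [hsq] at h
    refine h.trans (le_of_eq ?_)
    rw [hCcdef, hudef, div_eq_mul_inv, div_eq_mul_inv]
    ring
  have h2 : ∀ x, ‖(2 : ℝ) • principalPart P S 𝔚 𝒟.cut.η 𝒟.D t x + correctorPart P S 𝔚 𝒟.cut.η 𝒟.D t x‖ ≤
      2 * (Co * s) + Cc * (s * u) := fun x =>
    (norm_add_le _ _).trans (add_le_add
      (by rw [norm_smul, Real.norm_eq_abs, abs_two]; exact mul_le_mul_of_nonneg_left (hwo x) two_pos.le)
      (hwc x))
  have heq : (fun x => 2 * ⟪principalPart P S 𝔚 𝒟.cut.η 𝒟.D t x, correctorPart P S 𝔚 𝒟.cut.η 𝒟.D t x⟫_ℝ +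
      ‖correctorPart P S 𝔚 𝒟.cut.η 𝒟.D t x‖ ^ 2) = fun x =>
      ⟪(2 : ℝ) • principalPart P S 𝔚 𝒟.cut.η 𝒟.D t x + correctorPart P S 𝔚 𝒟.cut.η 𝒟.D t x,
        correctorPart P S 𝔚 𝒟.cut.η 𝒟.D t x⟫_ℝ := by
    funext x
    rw [inner_add_left, real_inner_smul_left, real_inner_self_eq_norm_sq]
  rw [heq]
  have hB0 : 0 ≤ 2 * (Co * s) + Cc * (s * u) :=
    add_nonneg (mul_nonneg two_pos.le (mul_nonneg hCo hs0)) (mul_nonneg hCc (mul_nonneg hs0 hu0))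
  refine (abs_integral_inner_le h2 hwc hB0).trans ?_
  have hs2 : s ^ 2 = amp P.β P.a P.b (S.q + 1) := by
    rw [hsdef, Real.sq_sqrt (amp_pos ha _).le]
  have hkey : (2 * (Co * s) + Cc * (s * u)) * (Cc * (s * u)) =
      2 * Co * Cc * (s ^ 2 * u) + Cc ^ 2 * (s ^ 2 * u) * u := by ring
  rw [hkey]
  have hP : 0 ≤ Cc ^ 2 * (s ^ 2 * u) := mul_nonneg (sq_nonneg _) (mul_nonneg (sq_nonneg _) hu0)
  calc 2 * Co * Cc * (s ^ 2 * u) + Cc ^ 2 * (s ^ 2 * u) * u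
      ≤ 2 * Co * Cc * (s ^ 2 * u) + Cc ^ 2 * (s ^ 2 * u) * 1 :=
        add_le_add le_rfl (mul_le_mul_of_nonneg_left hu1 hP)
    _ = (2 * Co * Cc + Cc ^ 2) * (amp P.β P.a P.b (S.q + 1) * ℓ⁻¹ * lam⁻¹) := by
        rw [hs2, hudef]; ring

/-- **Discharge of G₂ `BDSV.energy_correctorTerm`** (BDSV, proof of Prop. 6.2, second estimate):
along the common prefix, `|∫_{T³} 2w_o·w_c + |w_c|² dx| ≤ C δ_{q+1} ℓ⁻¹ λ_{q+1}⁻¹` for every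
`t ∈ [0,T]`, with `α₀ = min(βb(b-1), (b-1)(1-β)/2)`, `N̄ = 1`, the constant of
`BDSV.PerturbationData.abs_integral_corrector_le` (with `C_in⁺ = max(C_in, 0)` and `C_V` the bound of
the Mikado potential and its first derivative on the Mikado ball), and `a₀` the largest of the
thresholds of `4δ_{q+2} ≤ δ_{q+1}λ_q^{-α}`, `exp(4C_in⁺ℓ^{2α}) - 1 ≤ 1/300`,
`800(1 + ‖ofCols‖)C_in⁺(λ_qℓ)^α ≤ 1` and `ℓλ_{q+1} ≥ 1`.
[cite: BuckmasterEtAl2018, Prop. 6.2 (proof, estimate of ∫ 2w_o·w_c + |w_c|²)] -/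
theorem energy_correctorTerm_holds : energy_correctorTerm := by
  intro 𝔚 c₀ hc₀ Cη β hβ hβ' b hb hb'
  have hb0 : (0 : ℝ) < b := by linarith
  have hb1 : 0 < b - 1 := by linarith
  have h1β : 0 < 1 - β := by linarith
  refine ⟨min (β * b * (b - 1)) ((b - 1) * (1 - β) / 2),
    lt_min (mul_pos (mul_pos hβ hb0) hb1) (div_pos (mul_pos hb1 h1β) two_pos),
    fun α hα hαlt => ⟨1, fun Cin C₀ => ?_⟩⟩
  have hα₁ : α < β * b * (b - 1) := lt_of_lt_of_le hαlt (min_le_left _ _)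
  have hα₂ : α < (b - 1) * (1 - β) / 2 := lt_of_lt_of_le hαlt (min_le_right _ _)
  have hαb : α < 2 * β * b * (b - 1) := by nlinarith [mul_pos (mul_pos hβ hb0) hb1]
  have hαb' : 3 * α / 2 < (b - 1) * (1 - β) := by nlinarith [mul_pos hb1 h1β]
  have hCp0 : 0 ≤ max Cin 0 := le_max_right _ _
  obtain ⟨a₁, ha₁, hpar₁⟩ := exists_threshold_four_amp hb hαb
  obtain ⟨a₂, ha₂, hpar₂⟩ := exists_threshold_deformation hβ.le hb.le hα hCp0 (b := b)
  obtain ⟨a₃, ha₃, hpar₃⟩ := exists_threshold_freq_mul_mollScale_rpow_le hβ.le hb.le hα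
    (800 * (1 + ‖ofColsCL‖) * max Cin 0) one_pos
  obtain ⟨a₄, ha₄, hpar₄⟩ := exists_threshold_mollScale_freq_succ hb.le hαb' 1
  obtain ⟨CV, hCV0, hCV⟩ := exists_forall_le_norm_iteratedFDeriv_mikadoLiftCL_le
    𝔚.contDiff_mikadoLift_V isCompact_mikadoBallCL 1
  refine ⟨2 * (4 * ‖curlCLM‖ * ‖transposeCL‖ * CV / Real.sqrt c₀) *
      (2 * Real.pi * ‖curlCLM‖ * ‖transposeCL‖ * CV * (18 * ‖transposeCL‖ + 1 + 2 * max (Cη 0 1) 0) /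
        Real.sqrt c₀) +
      (2 * Real.pi * ‖curlCLM‖ * ‖transposeCL‖ * CV * (18 * ‖transposeCL‖ + 1 + 2 * max (Cη 0 1) 0) /
        Real.sqrt c₀) ^ 2,
    max (max a₁ a₂) (max a₃ a₄), lt_max_of_lt_left (lt_max_of_lt_left ha₁), fun a ha S H 𝒟 t ht => ?_⟩
  have ha₁' : a₁ ≤ a := le_trans (le_max_left _ _) (le_trans (le_max_left _ _) ha)
  have ha₂' : a₂ ≤ a := le_trans (le_max_right _ _) (le_trans (le_max_left _ _) ha)
  have ha₃' : a₃ ≤ a := le_trans (le_max_left _ _) (le_trans (le_max_right _ _) ha)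
  have ha₄' : a₄ ≤ a := le_trans (le_max_right _ _) (le_trans (le_max_right _ _) ha)
  have ha1 : (1 : ℝ) ≤ a := ha₁.le.trans ha₁'
  exact 𝒟.abs_integral_corrector_le (H.mono_const ha1 (le_max_left _ _)) 𝔚 hc₀ hCp0 ha1 hb.le hβ.le
    hα.le le_rfl (hpar₁ a ha₁' S.q) (hpar₂ a ha₂' S.q) (hpar₃ a ha₃' S.q) (hpar₄ a ha₄' S.q) hCV0 hCV ht

end Discharge

end BDSV

end Literature.Analysis.FluidPDE
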